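import Literature.Computability.Complexity.ACRealizeOver
import Literature.Computability.Complexity.CircuitInputMap
import HarnessLib

/-!
# Substituting variables and constants for the inputs of a circuit, over any basis `⊇ acBasis`

Projection closure (Vollmer 1999, §1.2) for the straight-line circuits of
`Literature.Computability.Complexity.Circuit`, in the form needed for constant-depth classes WITH
extra gates (`accBasis p = acBasis ∪ {MOD_{p,k}}`, `tcBasis`, …), where the constant-propagation
lemma `Circuit.exists_restrict` (`CircuitRestriction.lean`, basis `acBasis` only) does not apply:

* `Circuit.exists_subst` — for a circuit `C` on `n` inputs over a basis `B ⊇ acBasis` and a map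
  of cubes `e : {0,1}ᵏ → {0,1}ⁿ` each of whose coordinates is a CONSTANT or one of the `k`
  VARIABLES, there is a circuit over the same basis `B` on `k` inputs computing `u ↦ C(e u)`, with
  `acDepth ≤ acDepth C + 1` and `size ≤ size C + 2` (rename the variable coordinates with
  `Circuit.mapInputs`, free; realise the two constants once each by the `0`-ary gates `∧₀ = 1`,
  `∨₀ = 0` of `acBasis` and plug them in with `acRealOver_circuit_comp`).

This is the hard-wiring step of averaging arguments (fix the random string; fix the part of the
input that does not vary) for `AC⁰[p]`-type circuits; the companion statement for polynomials is
`Smolensky.comp_subst_mem_lowDeg` (`MetaComplexity/SmolenskyCorrelationRestrict.lean`).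

## References

* H. Vollmer, *Introduction to Circuit Complexity*, Springer 1999, §1.2 (projections of circuit
  classes: substituting constants and variables) [Vollmer1999].
-/

namespace Literature.Computability.Complexity

open Finset

namespace Circuit

/-- **Substitution of variables and constants, any basis `⊇ acBasis`** (Vollmer 1999, §1.2:
projection closure). Let `C` be a circuit on `n` inputs over `B ⊇ acBasis` and
`e : {0,1}ᵏ → {0,1}ⁿ` a map each of whose coordinates is constant or a variable
(`∀ i, (∃ b, ∀ x, e x i = b) ∨ (∃ j, ∀ x, e x i = x j)`). Then some circuit `C'` over `B` on `k`
inputs computes `u ↦ C (e u)` with `acDepth C' ≤ acDepth C + 1` and `size C' ≤ size C + 2`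
(rename inputs along `e`, then feed the constant coordinates from one `∧₀` and one `∨₀` gate).
[cite: Vollmer1999, §1.2] -/
theorem exists_subst {B : Set GateFn} (hB : acBasis ⊆ B) {k n : ℕ} (C : Circuit (Fin n))
    (hC : C.IsOver B) (e : (Fin k → Bool) → (Fin n → Bool))
    (he : ∀ i, (∃ b, ∀ x, e x i = b) ∨ (∃ j, ∀ x, e x i = x j)) :
    ∃ C' : Circuit (Fin k), C'.IsOver B ∧ C'.acDepth ≤ C.acDepth + 1 ∧ C'.size ≤ C.size + 2 ∧
      ∀ u, C'.eval u = C.eval (e u) := by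
  classical
  -- choose, for each coordinate, the constant or the variable it equals
  have hdata : ∀ i : Fin n, ∃ w : Bool ⊕ Fin k, ∀ x, e x i = Sum.elim (fun b => b) (fun j => x j) w := by
    intro i
    rcases he i with ⟨b, hb⟩ | ⟨j, hj⟩
    · exact ⟨Sum.inl b, fun x => by rw [hb x]; rfl⟩
    · exact ⟨Sum.inr j, fun x => by rw [hj x]; rfl⟩
  choose w hw using hdata
  -- rename: variables `j ↦ castAdd 2 j`, the constant `b ↦ natAdd k (0 or 1)`
  let e' : Fin n → Fin (k + 2) := fun i =>
    Sum.elim (fun b => Fin.natAdd k (if b then 1 else 0)) (fun j => Fin.castAdd 2 j) (w i)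
  let C₁ : Circuit (Fin (k + 2)) := C.mapInputs e'
  have hC₁ : C₁.IsOver B := hC.mapInputs e'
  -- the realizations plugged into the `k + 2` inputs of `C₁`: variables and the two constants
  let f : Fin (k + 2) → (Fin k → Bool) → Bool :=
    fun j u => Fin.addCases (fun j' => u j') (fun c => decide (c = 1)) j
  let s : Fin (k + 2) → ℕ := fun j => Fin.addCases (fun _ => 0) (fun _ => 1) j
  have hf : ∀ j, ACRealOver B (f j) 1 (s j) := by
    intro j
    induction j using Fin.addCases with
    | left j' =>
      have h1 : f (Fin.castAdd 2 j') = fun u => u j' := by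
        funext u; simp [f]
      have h2 : s (Fin.castAdd 2 j') = 0 := by simp [s]
      rw [h1, h2]
      exact (acRealOver_input B j').mono zero_le_one le_rfl
    | right c =>
      have h1 : f (Fin.natAdd k c) = fun _ => decide (c = 1) := by
        funext u; simp [f]
      have h2 : s (Fin.natAdd k c) = 1 := by simp [s]
      rw [h1, h2]
      exact acRealOver_const hB _
  have hreal := acRealOver_circuit_comp C₁ hC₁ hf
  have hsum : ∑ j, s j = 2 := by
    rw [Fin.sum_univ_add]
    simp [s]
  rw [hsum] at hreal
  obtain ⟨C', hC', hd', hs', hev'⟩ := hreal.toCircuit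
  refine ⟨C', hC', ?_, ?_, fun u => ?_⟩
  · refine hd'.trans ?_
    change (C.mapInputs e').acDepth + 1 ≤ C.acDepth + 1
    rw [acDepth_mapInputs]
  · refine hs'.trans ?_
    change (C.mapInputs e').size + 2 ≤ C.size + 2
    rw [size_mapInputs]
  · rw [hev' u]
    change (C.mapInputs e').eval (fun j => f j u) = C.eval (e u)
    rw [eval_mapInputs]
    congr 1
    funext i
    rw [hw i u]
    cases hi : w i with
    | inl b => cases b <;> simp [e', f, hi]
    | inr j => simp [e', f, hi]

end Circuit

end Literature.Computability.Complexity
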